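import Summits.RiemannHypothesis.RiemannHypothesis.Theorems.Splittings.BombieriTruncEventualStrip

/-!
# Splittings — x-wuc (xiv-b4): the SZC-free PENCIL form `PENCIL_L([−a,a]) ⟺ B′([−a,a])` and FINITE-LEVEL EXACTNESS `RH ⟺ NoNegRoot a`

Cell rh-split, seat rh-split-x-wuc g5 (brief sha16 f79c5f09d8bcb036), card `run/shared/lean/pub/rh-split/cards/SPLIT-x-wuc.md` §11
(referee rh-split-ref g3 2026-08-27T06:23:10Z: REPLAY PASS of the scratch `HOME/rh-split-x-wuc/SplitXWucG5.lean`; lead RULING #35: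
cut (xiv)).  Carved VERBATIM from that scratch (file of record sha16 66b013c38c58c722); sections as numbered there.
* §12 `eigvec_mem_classSub`, `screening_of_negRoot_mult`, `PencilNonnegClass`, `pencilNonnegClass_iff_boundedAway` (no hypothesis), row X-5 in pencil
  form modulo `Corollary11Prov`; §15 `exists_negRoot_of_offLine` (an off-line slot forces a negative real root — existence half of Bombieri Thm 9),
  `noOffLine_iff_noNegRoot`, `NoNegRoot`, `rh_iff_noNegRoot (ha : 0 < a) : RH ↔ NoNegRoot a` (UNCONDITIONAL; honest class: «RH ⟺ ∀ N, RH(Γ_N)»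
  in matrix clothing — a perfect-detector row, not a splitting), `boundedAway_of_noNegRoot`.
HONEST LABEL: «SPLITTING SEARCH over kernel-typed RH-EQUIVALENCES; a splitting A ∧ B ⟹ RH is CONDITIONAL bookkeeping
unless A and B are both proved; nothing here bears on the truth of RH.»
-/

set_option linter.dupNamespace false

noncomputable section

open scoped Classical ComplexConjugate
open Set Filter Topology Complex MeasureTheory

namespace Summit.RiemannHypothesis.RiemannHypothesis.Theorems.Splittings.BombieriTruncExactness

open Literature.NumberTheory.LFunctions Literature.NumberTheory.LFunctions.Bombieri2000
open Summit.RiemannHypothesis.RiemannHypothesis.Theses.RuelleBand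
open Summit.RiemannHypothesis.RiemannHypothesis.Theorems.Splittings.BombieriTruncEigen
open Summit.RiemannHypothesis.RiemannHypothesis.Theorems.Splittings.BombieriFozNoDep
open Summit.RiemannHypothesis.RiemannHypothesis.Theorems.Splittings.BombieriTruncGram
open Summit.RiemannHypothesis.RiemannHypothesis.Theorems.Splittings.BombieriTruncPairing
open Summit.RiemannHypothesis.RiemannHypothesis.Theorems.Splittings.BombieriTruncScreening
open Summit.RiemannHypothesis.RiemannHypothesis.Theorems.Splittings.BombieriTruncBandGap
open Summit.RiemannHypothesis.RiemannHypothesis.Theorems.Splittings.BombieriTruncMultiplicity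
open Summit.RiemannHypothesis.RiemannHypothesis.Theorems.Splittings.BombieriTruncEventualStrip

variable {E : Set ℝ} {N : ℕ}

/-! ## §12 (K3-mult) The SZC-free pencil reformulation of Bombieri's question:
`B′([−a,a]) ⟺ ∃ c > 0, eventually ∀ x ∈ classSub N, ∫|F_x|² + c·Re⟨x, Px⟩ ≥ 0`

Eigenvectors of `𝒦_E(Γ_N)` with non-zero eigenvalue are automatically class-constant (rows of `𝒦` only see `γ`),
so the converse direction needs no positivity hypothesis beyond `cost_pos_of_mem_classSub`. -/

/-- Entry formula `(𝒦_E(Γ_N))_{l j} = K_E(γ_l, γ_j)`. -/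
theorem truncKMat_apply (l j : truncIdx N) :
    truncKMat E N l j = KE E ((l : ZeroIdx).gamma) ((j : ZeroIdx).gamma) := rfl

/-- `𝒦_E(Γ_N) · v` is class-constant for every `v` (rows depend only on the zero carried). -/
theorem mulVec_mem_classSub (v : truncIdx N → ℂ) : (truncKMat E N).mulVec v ∈ classSub N := by
  intro i j h
  have hg : (i : ZeroIdx).gamma = (j : ZeroIdx).gamma := by rw [ZeroIdx.gamma, ZeroIdx.gamma, h]
  simp only [Matrix.mulVec, dotProduct, truncKMat_apply, hg]

/-- Eigenvectors of `𝒦_E(Γ_N)` with nonzero eigenvalue are class-constant. -/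
theorem eigvec_mem_classSub {μ : ℂ} (hμ : μ ≠ 0) {v : truncIdx N → ℂ} (hv : (truncKMat E N).mulVec v = μ • v) :
    v ∈ classSub N := by
  have h : v = μ⁻¹ • (truncKMat E N).mulVec v := by rw [hv, smul_smul, inv_mul_cancel₀ hμ, one_smul]
  rw [h]
  exact (classSub N).smul_mem _ (mulVec_mem_classSub v)

/-- **(K2-mult converse)** a negative real eigenvalue in `(−c, 0)` of `𝒦_{[−a,a]}(Γ_N)` yields a `c`-cheap
CLASS-CONSTANT vector — no simplicity hypothesis. [new] -/
theorem screening_of_negRoot_mult {a : ℝ} (ha : 0 < a) {c : ℝ} {μ : ℂ}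
    (hμ : μ ∈ (truncKMat (Icc (-a) a) N).charpoly.roots) (him : μ.im = 0) (hlo : -c < μ.re) (hhi : μ.re < 0) :
    ∃ x ∈ classSub N, ∫ u in Icc (-a) a, ‖F N x u‖ ^ 2 < c * -(pairing N x x).re := by
  obtain ⟨v, hv0, hv⟩ := Literature.Analysis.InnerProduct.exists_mulVec_eq_smul_of_mem_roots_charpoly hμ
  have hμ0 : μ ≠ 0 := fun h ↦ by rw [h, Complex.zero_re] at hhi; exact lt_irrefl _ hhi
  have hvL : v ∈ classSub N := eigvec_mem_classSub hμ0 hv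
  refine ⟨v, hvL, ?_⟩
  have h1 : gram (Icc (-a) a) N v v = μ * pairing N v v := gram_eigvec hv v
  have h2 : ∫ u in Icc (-a) a, ‖F N v u‖ ^ 2 = μ.re * (pairing N v v).re := by
    rw [← gram_self_re subset_rfl, h1, Complex.mul_re, him, zero_mul, sub_zero]
  have h3 : 0 < ∫ u in Icc (-a) a, ‖F N v u‖ ^ 2 := cost_pos_of_mem_classSub ha hvL hv0
  have h4 : (pairing N v v).re < 0 := by
    by_contra h
    push Not at h
    rw [h2] at h3
    nlinarith
  rw [h2]
  nlinarith

/-- **PENCIL_L**: the pencil form is eventually non-negative on CLASS-CONSTANT vectors. -/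
@[conjecture] def PencilNonnegClass (E : Set ℝ) : Prop :=
  ∃ c : ℝ, 0 < c ∧ ∃ N₀ : ℕ, ∀ N ≥ N₀, ∀ x ∈ classSub N,
    0 ≤ (∫ u in E, ‖F N x u‖ ^ 2) + c * (pairing N x x).re

/-- **(K3-mult) `PENCIL_L([−a,a]) ⟺ B′([−a,a])` for every window, NO simplicity hypothesis:** Bombieri's question
«does the negative eigenvalue stay bounded away from 0» is the question whether some fixed multiple of the
indefinite form `Re Σ x̄_γ x_γ̄` is dominated by the `L²([−a,a])`-energy of `Σ x_γ e^{−iγu}` on class-constant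
coefficient vectors, uniformly in the level. [new] -/
theorem pencilNonnegClass_iff_boundedAway {a : ℝ} (ha : 0 < a) :
    PencilNonnegClass (Icc (-a) a) ↔ TruncNegEigenvalueBoundedAway (Icc (-a) a) := by
  constructor
  · rintro ⟨c, hc, N₀, h⟩
    refine ⟨c, hc, N₀, fun N hN μ hμ him hneg ↦ ?_⟩
    by_contra hlt
    push Not at hlt
    obtain ⟨x, hxL, hx⟩ := screening_of_negRoot_mult ha hμ him hlt hneg
    have := h N hN x hxL
    linarith
  · rintro ⟨c, hc, N₀, h⟩
    refine ⟨c, hc, N₀, fun N hN x hxL ↦ ?_⟩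
    by_contra hlt
    push Not at hlt
    have hx : ∫ u in Icc (-a) a, ‖F N x u‖ ^ 2 < c * -(pairing N x x).re := by linarith
    obtain ⟨μ, hμ, him, hlo, hhi⟩ := exists_negRoot_of_screening_mult ha hc hxL hx
    have := h N hN μ hμ him hhi
    linarith

/-- Row X-5 in pencil form, NO simplicity hypothesis: `RH ⟺ ES_m ∧ PENCIL_L([−1,1])` (modulo row C5 and
`RH → B′`). [new-combination] -/
theorem rh_iff_eventualStripMult_and_pencilClass
    (hC5 : CofiniteCriticalLine → TruncNegEigenvalueBoundedAway (Icc (-1) 1) → _root_.RiemannHypothesis)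
    (hBrh : _root_.RiemannHypothesis → TruncNegEigenvalueBoundedAway (Icc (-1) 1)) :
    _root_.RiemannHypothesis ↔ EventualStripMult ∧ PencilNonnegClass (Icc (-1) 1) := by
  rw [pencilNonnegClass_iff_boundedAway one_pos]
  exact rh_iff_eventualStripMult_and_boundedAway hC5 hBrh

open Summit.RiemannHypothesis.RiemannHypothesis.Theorems.Splittings.BombieriCorollaryProvenance in
/-- Row X-5 in pencil form, modulo `Corollary11Prov` only: `RH ⟺ ES_m ∧ PENCIL_L([−1,1])`. [new-combination] -/
theorem rh_iff_eventualStripMult_and_pencilClass_prov (h : Corollary11Prov) :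
    _root_.RiemannHypothesis ↔ EventualStripMult ∧ PencilNonnegClass (Icc (-1) 1) :=
  rh_iff_eventualStripMult_and_pencilClass (fun hfoz hB ↦ rh_of_foz_of_boundedAway_one h hfoz hB)
    (fun hRH ↦ truncNegEigenvalueBoundedAway_Icc_of_rh hRH 1)

/-! ## §15 FINITE-LEVEL EXACTNESS: `𝒦_{[−a,a]}(Γ_N)` has a root with negative real part iff `Γ_N` carries an
OFF-LINE zero (unconditional, SZC-free), hence `RH ⟺ ∀ N, 𝒦_{[−a,a]}(Γ_N)` has no such root — every window,
no named fact. The existence half of Bombieri's Theorem 9 count by three lines of `P·G` + the class screening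
vector; for the cell: the negative-spectrum statistics of the W-screens are EXACT DETECTORS of off-line zeros
below the truncation height. [new-in-kernel] -/

/-- An off-line slot in `Γ_N` forces a negative real root (class screening vector at a large `c`). -/
theorem exists_negRoot_of_offLine {a : ℝ} (ha : 0 < a) (i : truncIdx N) (hi : (i : ZeroIdx).OffLine) :
    ∃ μ ∈ (truncKMat (Icc (-a) a) N).charpoly.roots, μ.im = 0 ∧ μ.re < 0 := by
  set K : ℝ := ∫ u in Icc (-a) a, ‖F N (classVec i) u‖ ^ 2 with hK
  have hK0 : 0 ≤ K := integral_nonneg fun u ↦ by positivity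
  have hm : 0 < ((fib i).card : ℝ) := by exact_mod_cast fib_card_pos i
  have hp : (pairing N (classVec i) (classVec i)).re = -2 * (fib i).card := by
    rw [pairing_classVec hi]; simp
  have hc : 0 < K / (2 * (fib i).card) + 1 := by positivity
  have hx : ∫ u in Icc (-a) a, ‖F N (classVec i) u‖ ^ 2 <
      (K / (2 * (fib i).card) + 1) * -(pairing N (classVec i) (classVec i)).re := by
    rw [← hK, hp]
    have : (K / (2 * (fib i).card) + 1) * -(-2 * ((fib i).card : ℝ)) = K + 2 * (fib i).card := by
      field_simp
    rw [this]
    linarith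
  obtain ⟨μ, hμ, him, -, hneg⟩ := exists_negRoot_of_screening_mult ha hc (classVec_mem i) hx
  exact ⟨μ, hμ, him, hneg⟩

/-- If every slot of `Γ_N` is on the line then `𝒦 = G ⪰ 0`: no root with negative real part. -/
theorem re_nonneg_of_noOffLine {a : ℝ} (hE : E ⊆ Icc (-a) a) (h : ∀ i : truncIdx N, ¬ (i : ZeroIdx).OffLine)
    {μ : ℂ} (hμ : μ ∈ (truncKMat E N).charpoly.roots) : 0 ≤ μ.re := by
  obtain ⟨v, hv0, hv⟩ := Literature.Analysis.InnerProduct.exists_mulVec_eq_smul_of_mem_roots_charpoly hμ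
  have h1 : gram E N v v = μ * pairing N v v := gram_eigvec hv v
  have hp : pairing N v v = ((∑ j, ‖v j‖ ^ 2 : ℝ) : ℂ) := by
    simp only [pairing]
    push_cast
    exact Finset.sum_congr rfl fun j _ ↦ by rw [tbar_eq_self (h j), RCLike.conj_mul]; norm_cast
  obtain ⟨i₀, hi₀⟩ : ∃ i, v i ≠ 0 := by
    by_contra h'
    push Not at h'
    exact hv0 (funext h')
  have hpos : 0 < ∑ i, ‖v i‖ ^ 2 :=
    lt_of_lt_of_le (by positivity : 0 < ‖v i₀‖ ^ 2)
      (Finset.single_le_sum (f := fun i ↦ ‖v i‖ ^ 2) (fun i _ ↦ by positivity) (Finset.mem_univ i₀))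
  have hg := gram_self_nonneg hE v
  rw [h1, hp, Complex.mul_re, Complex.ofReal_re, Complex.ofReal_im, mul_zero, sub_zero] at hg
  by_contra hlt
  push Not at hlt
  nlinarith

/-- **EXACTNESS.** On `[−a,a]`: all slots of `Γ_N` on the line ⟺ no characteristic root of `𝒦(Γ_N)` has
negative real part. [new-in-kernel] -/
theorem noOffLine_iff_noNegRoot {a : ℝ} (ha : 0 < a) :
    (∀ i : truncIdx N, ¬ (i : ZeroIdx).OffLine) ↔
      ∀ μ ∈ (truncKMat (Icc (-a) a) N).charpoly.roots, 0 ≤ μ.re :=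
  ⟨fun h μ hμ ↦ re_nonneg_of_noOffLine subset_rfl h hμ, fun h i hi ↦ by
    obtain ⟨μ, hμ, -, hneg⟩ := exists_negRoot_of_offLine ha i hi
    exact absurd (h μ hμ) (not_le.2 hneg)⟩

/-- «No truncation on the window `[−a,a]` has a root with negative real part.» -/
@[conjecture] def NoNegRoot (a : ℝ) : Prop :=
  ∀ N : ℕ, ∀ μ ∈ (truncKMat (Icc (-a) a) N).charpoly.roots, 0 ≤ μ.re

/-- **`RH ⟺ NoNegRoot a` for every `a > 0`** — unconditional, no named fact, no simplicity hypothesis: level `N`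
of `NoNegRoot` is EXACTLY «RH for the zeros in `Γ_N`». (So this equivalence is `RH ⟺ ∀ N, RH(Γ_N)` in matrix
clothing — a PERFECT DETECTOR row in the cell's sense, recorded as such, not a splitting.) [new-in-kernel] -/
theorem rh_iff_noNegRoot {a : ℝ} (ha : 0 < a) : _root_.RiemannHypothesis ↔ NoNegRoot a := by
  constructor
  · intro hRH N
    exact (noOffLine_iff_noNegRoot ha).1 fun i hi ↦ hi (re_eq_half_of_rh hRH (i : ZeroIdx).val_mem)
  · intro h
    by_contra hRH
    obtain ⟨ρ, hρ, hoff⟩ := exists_offLine_of_not_rh hRH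
    obtain ⟨i, hi⟩ := exists_slot hρ
    obtain ⟨N, hN⟩ := exists_nat_ge ‖i.val - 1 / 2‖
    have hmem : i ∈ truncIdx N := mem_truncIdx_of_le hN
    have hoff' : (i : ZeroIdx).OffLine := by rw [ZeroIdx.OffLine, hi]; exact hoff
    exact (noOffLine_iff_noNegRoot ha).2 (h N) ⟨i, hmem⟩ hoff'

/-- B′ is weaker than `NoNegRoot` level by level (trivially): `NoNegRoot a → B′([−a,a])`. -/
theorem boundedAway_of_noNegRoot {a : ℝ} (h : NoNegRoot a) : TruncNegEigenvalueBoundedAway (Icc (-a) a) :=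
  ⟨1, one_pos, 0, fun N _ μ hμ _ hneg ↦ absurd (h N μ hμ) (not_le.2 hneg)⟩

end Summit.RiemannHypothesis.RiemannHypothesis.Theorems.Splittings.BombieriTruncExactness
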